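import Literature.NumberTheory.DiophantineGeometry.PartitionTableauxProofs
import HarnessLib

/-!
# A dimension dichotomy for `S_d`-irreducibles: short first row AND short first column force
# `f^μ ≥ 2^{⌊t/2⌋}` (branching-rule corollary)

For a partition `μ ⊢ d` write `f^μ` for the number of standard Young tableaux of shape `μ`
(= `dim S^μ`; the tree's `numStandardTableaux`). The branching rule
`f^λ = Σ_{corners c} f^{λ ∖ c}` (James–Kerber 2.4.3 / Fulton §7.2 (8); in the tree
`card_stdFilling_succ_eq_sum_corners`) is the classical tool for lower bounds on the small
degrees of `S_d` (James–Kerber, *The Representation Theory of the Symmetric Group*, Thm. 2.4.10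
and its proof: "we would now like to derive a few of them by various applications of the
branching theorem"; rectangles are the one-corner case there as here). This file proves the
following uniform quantitative form, which is the shape used by the matching-psd-rank cell
(HOME/pnp-psdrank-p2/TARGET.md, lemma T-D.3 `SpechtDimDichotomy`, statement copied verbatim):

  if `μ₁ + t ≤ d` and `μ'₁ + t ≤ d` (first row and first column both of length `≤ d - t`)
  then `2^{⌊t/2⌋} ≤ f^μ`  (`spechtDimDichotomy`).

Contrapositive: an irreducible of dimension `< 2^k` has first row or first column of length
`> d - 2k`. Proof (`card_stdFilling_ge_two_pow`, for arbitrary Young diagrams, strong induction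
on the number of cells): removing a corner keeps the hypothesis with `t - 1`; a diagram with two
corners gains a factor `2`; a one-corner diagram is a rectangle `a × b` (`a, b ≥ 2` once `t ≥ 2`),
loses nothing in one step and has two corners afterwards (`t ↦ t - 2`).

## References

* G. James, A. Kerber, *The Representation Theory of the Symmetric Group*, Encyclopedia Math.
  Appl. 16 (1981/1984), 2.4.3 (branching theorem), 2.4.10 (lowest dimensions, proof by branching).
  [JamesKerber1981]
* W. Fulton, *Young Tableaux*, LMS Student Texts 35 (1997), §7.2, formula (8). [FultonYoungTableaux1997]
-/

open scoped BigOperators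

namespace Literature.NumberTheory.DiophantineGeometry

open YoungDiagram Finset

/-! ### Elementary bounds on Young diagrams -/

/-- Every row is at most as long as the diagram is large. [cite: FultonYoungTableaux1997, §7.2] -/
theorem rowLen_le_card_cells (Y : YoungDiagram) (i : ℕ) : Y.rowLen i ≤ Y.cells.card := by
  rw [Y.rowLen_eq_card]
  exact card_le_card fun c hc => (Y.mem_cells c).2 (mem_row_iff.1 hc).1

/-- Every column is at most as long as the diagram is large. [cite: FultonYoungTableaux1997, §7.2] -/
theorem colLen_le_card_cells (Y : YoungDiagram) (j : ℕ) : Y.colLen j ≤ Y.cells.card := by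
  rw [Y.colLen_eq_card]
  exact card_le_card fun c hc => (Y.mem_cells c).2 (mem_col_iff.1 hc).1

/-- All cells lie in rows `< colLen 0` (the number of rows). [cite: FultonYoungTableaux1997, §7.2] -/
theorem fst_lt_colLen_zero {Y : YoungDiagram} {c : ℕ × ℕ} (hc : c ∈ Y.cells) : c.1 < Y.colLen 0 := by
  rw [← mem_iff_lt_colLen]
  exact Y.up_left_mem le_rfl (Nat.zero_le _) ((Y.mem_cells _).1 hc)

/-- `removeAbove` does not lengthen rows. [cite: FultonYoungTableaux1997, §7.2] -/
theorem rowLen_removeAbove_le (Y : YoungDiagram) (c : ℕ × ℕ) (i : ℕ) :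
    (Y.removeAbove c).rowLen i ≤ Y.rowLen i := by
  by_contra h
  push Not at h
  have := mem_of_mem_removeAbove (mem_iff_lt_rowLen.2 h)
  exact lt_irrefl _ (mem_iff_lt_rowLen.1 this)

/-- `removeAbove` does not lengthen columns. [cite: FultonYoungTableaux1997, §7.2] -/
theorem colLen_removeAbove_le (Y : YoungDiagram) (c : ℕ × ℕ) (j : ℕ) :
    (Y.removeAbove c).colLen j ≤ Y.colLen j := by
  by_contra h
  push Not at h
  have := mem_of_mem_removeAbove (mem_iff_lt_colLen.2 h)
  exact lt_irrefl _ (mem_iff_lt_colLen.1 this)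

/-- The last row of a nonempty diagram ends in a corner. [cite: FultonYoungTableaux1997, §7.2] -/
theorem rowLen_colLen_zero_lt {Y : YoungDiagram} (h : 0 < Y.colLen 0) :
    Y.rowLen (Y.colLen 0 - 1 + 1) < Y.rowLen (Y.colLen 0 - 1) := by
  have h1 : Y.rowLen (Y.colLen 0 - 1 + 1) = 0 := by
    rw [Nat.sub_add_cancel h]
    exact rowLen_eq_zero_of_forall_lt fun c hc => fst_lt_colLen_zero hc
  have h2 : 0 < Y.rowLen (Y.colLen 0 - 1) :=
    mem_iff_lt_rowLen.1 (mem_iff_lt_colLen.2 (by omega))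
  omega

/-- `2^{⌊a/2⌋} ≤ 2 · 2^{⌊(a-1)/2⌋}`-type step: `2^p ≤ 2 · 2^q` when `p ≤ q + 1`. [cite: FultonYoungTableaux1997, §7.2] -/
theorem two_pow_le_two_mul_two_pow {p q : ℕ} (h : p ≤ q + 1) : 2 ^ p ≤ 2 * 2 ^ q := by
  calc 2 ^ p ≤ 2 ^ (q + 1) := Nat.pow_le_pow_right (by norm_num) h
    _ = 2 * 2 ^ q := by rw [pow_succ, mul_comm]

/-! ### The dichotomy for Young diagrams -/

/-- **Corner-branching lower bound.** A Young diagram with `m` cells whose rows and columns all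
have length `≤ m - t` has at least `2^{⌊t/2⌋}` standard fillings. (Strong induction on `m` via the
branching rule over corners; the one-corner case is a rectangle.)
[cite: JamesKerber1981, 2.4.3 and proof of 2.4.10 (lower bounds for dimensions by branching)] -/
theorem card_stdFilling_ge_two_pow : ∀ (m t : ℕ) (Y : YoungDiagram), Y.cells.card = m →
    Y.rowLen 0 + t ≤ m → Y.colLen 0 + t ≤ m → 2 ^ (t / 2) ≤ Nat.card (StdFilling m Y) := by
  intro m
  induction m using Nat.strong_induction_on with
  | _ m ih =>
  intro t Y hY hrow hcol
  rcases m with _ | m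
  · -- no cells: `t = 0`, one (empty) filling
    have ht : t = 0 := by omega
    subst ht
    rw [StdFilling.card_zero]
    norm_num
  · -- `m + 1` cells: branch over the corners
    set N := Y.colLen 0 with hNdef
    have hN : ∀ c ∈ Y.cells, c.1 < N := fun c hc => fst_lt_colLen_zero hc
    have hNpos : 0 < N := by
      obtain ⟨c, hc⟩ : Y.cells.Nonempty := by
        rw [← Finset.card_pos, hY]; exact Nat.succ_pos m
      exact lt_of_le_of_lt (Nat.zero_le _) (hN c hc)
    rw [card_stdFilling_succ_eq_sum_corners hY hN]
    set C := (Finset.range N).filter (fun r => Y.rowLen (r + 1) < Y.rowLen r) with hCdef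
    have hlast : N - 1 ∈ C :=
      mem_filter.2 ⟨mem_range.2 (by omega), rowLen_colLen_zero_lt hNpos⟩
    -- every corner term is bounded below by the induction hypothesis with `t - 1`
    have hterm : ∀ r ∈ C,
        2 ^ ((t - 1) / 2) ≤ Nat.card (StdFilling m (Y.removeAbove (r, Y.rowLen r - 1))) := by
      intro r hr
      have hcr := (mem_filter.1 hr).2
      have hcard : (Y.removeAbove (r, Y.rowLen r - 1)).cells.card = m := by
        rw [card_removeAbove_corner hcr, hY, Nat.add_sub_cancel]
      refine ih m (lt_add_one m) (t - 1) _ hcard ?_ ?_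
      · have := rowLen_removeAbove_le Y (r, Y.rowLen r - 1) 0
        have := rowLen_le_card_cells (Y.removeAbove (r, Y.rowLen r - 1)) 0
        omega
      · have := colLen_removeAbove_le Y (r, Y.rowLen r - 1) 0
        have := colLen_le_card_cells (Y.removeAbove (r, Y.rowLen r - 1)) 0
        omega
    by_cases h2 : 2 ≤ C.card
    · -- at least two corners: a factor `2`
      calc 2 ^ (t / 2) ≤ 2 * 2 ^ ((t - 1) / 2) := two_pow_le_two_mul_two_pow (by omega)
        _ ≤ C.card * 2 ^ ((t - 1) / 2) := Nat.mul_le_mul_right _ h2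
        _ = C.card • 2 ^ ((t - 1) / 2) := (smul_eq_mul _ _).symm
        _ ≤ ∑ r ∈ C, Nat.card (StdFilling m (Y.removeAbove (r, Y.rowLen r - 1))) :=
          card_nsmul_le_sum _ _ _ hterm
    · -- exactly one corner: `Y` is a rectangle `N × L`
      have hC1 : C.card = 1 := by
        have := Finset.card_pos.2 ⟨_, hlast⟩; omega
      obtain ⟨r₀, hC⟩ := Finset.card_eq_one.1 hC1
      have hr₀ : r₀ = N - 1 := by
        have := hlast; rw [hC, mem_singleton] at this; exact this.symm
      rw [hC, sum_singleton, hr₀]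
      set L := Y.rowLen 0 with hLdef
      have hrect : ∀ r, r < N → Y.rowLen r = L := by
        intro r
        induction r with
        | zero => intro; rfl
        | succ r ihr =>
          intro hr
          have h1 := ihr (by omega)
          have hnot : r ∉ C := by
            rw [hC, mem_singleton]; omega
          have hge : ¬ Y.rowLen (r + 1) < Y.rowLen r := fun h =>
            hnot (mem_filter.2 ⟨mem_range.2 (by omega), h⟩)
          have hle := Y.rowLen_anti r (r + 1) (Nat.le_succ r)
          omega
      have hmNL : m + 1 = N * L := by
        rw [← hY, card_cells_eq_sum_range_rowLen hN, Finset.sum_congr rfl fun r hr =>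
          hrect r (mem_range.1 hr), sum_const, card_range, smul_eq_mul]
      by_cases ht : t ≤ 1
      · -- nothing to gain: positivity from the induction hypothesis
        have h0 : t / 2 = 0 := by omega
        have h0' : (t - 1) / 2 = 0 := by omega
        have := hterm (N - 1) hlast
        rw [h0'] at this
        rwa [h0]
      · -- `t ≥ 2`: `L ≥ 2`, `N ≥ 2`; remove the corner and branch once more
        push Not at ht
        have hL2 : 2 ≤ L := by
          by_contra hL
          have : N * L ≤ N * 1 := Nat.mul_le_mul_left N (by omega)
          omega
        have hN2 : 2 ≤ N := by
          by_contra hN'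
          have : N * L ≤ 1 * L := Nat.mul_le_mul_right L (by omega)
          omega
        have hcorner : Y.rowLen (N - 1 + 1) < Y.rowLen (N - 1) := rowLen_colLen_zero_lt hNpos
        set Y' := Y.removeAbove (N - 1, Y.rowLen (N - 1) - 1) with hY'def
        have hY'card : Y'.cells.card = m := by
          rw [hY'def, card_removeAbove_corner hcorner, hY, Nat.add_sub_cancel]
        have hm1 : 1 ≤ m := by
          have : 2 * 2 ≤ N * L := Nat.mul_le_mul hN2 hL2
          omega
        obtain ⟨m', rfl⟩ : ∃ m', m = m' + 1 := ⟨m - 1, by omega⟩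
        have hN' : ∀ c ∈ Y'.cells, c.1 < N := fun c hc =>
          hN c ((Y.mem_cells c).2 (mem_of_mem_removeAbove ((Y'.mem_cells c).1 hc)))
        rw [card_stdFilling_succ_eq_sum_corners hY'card hN']
        -- the rows of `Y'`
        have hrowN1 : Y'.rowLen (N - 1) = L - 1 := by
          rw [hY'def, rowLen_removeAbove_corner_self hcorner, hrect (N - 1) (by omega)]
        have hrowN2 : Y'.rowLen (N - 2) = L := by
          rw [hY'def, rowLen_removeAbove_corner_of_ne hcorner (by omega), hrect (N - 2) (by omega)]
        have hrowN : Y'.rowLen N = 0 := by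
          rw [hY'def, rowLen_removeAbove_corner_of_ne hcorner (by omega)]
          exact rowLen_eq_zero_of_forall_lt hN
        set C' := (Finset.range N).filter (fun r => Y'.rowLen (r + 1) < Y'.rowLen r) with hC'def
        have hc1 : N - 2 ∈ C' := by
          refine mem_filter.2 ⟨mem_range.2 (by omega), ?_⟩
          rw [show N - 2 + 1 = N - 1 by omega, hrowN1, hrowN2]
          omega
        have hc2 : N - 1 ∈ C' := by
          refine mem_filter.2 ⟨mem_range.2 (by omega), ?_⟩
          rw [Nat.sub_add_cancel (by omega : 1 ≤ N), hrowN, hrowN1]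
          omega
        have hC'2 : 2 ≤ C'.card := by
          calc 2 = ({N - 2, N - 1} : Finset ℕ).card := by rw [card_pair (by omega)]
            _ ≤ C'.card := card_le_card (by
                intro x hx
                simp only [mem_insert, mem_singleton] at hx
                rcases hx with rfl | rfl
                · exact hc1
                · exact hc2)
        have hterm' : ∀ r ∈ C',
            2 ^ ((t - 2) / 2) ≤ Nat.card (StdFilling m' (Y'.removeAbove (r, Y'.rowLen r - 1))) := by
          intro r hr
          have hcr := (mem_filter.1 hr).2
          refine ih m' (by omega) (t - 2) _ ?_ ?_ ?_
          · rw [card_removeAbove_corner hcr, hY'card, Nat.add_sub_cancel]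
          · have h1 := rowLen_removeAbove_le Y' (r, Y'.rowLen r - 1) 0
            have h2 := rowLen_removeAbove_le Y (N - 1, Y.rowLen (N - 1) - 1) 0
            rw [← hY'def] at h2
            set P := N * L with hP
            omega
          · have h1 := colLen_removeAbove_le Y' (r, Y'.rowLen r - 1) 0
            have h2 := colLen_removeAbove_le Y (N - 1, Y.rowLen (N - 1) - 1) 0
            rw [← hY'def] at h2
            set P := N * L with hP
            omega
        calc 2 ^ (t / 2) ≤ 2 * 2 ^ ((t - 2) / 2) := two_pow_le_two_mul_two_pow (by omega)
          _ ≤ C'.card * 2 ^ ((t - 2) / 2) := Nat.mul_le_mul_right _ hC'2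
          _ = C'.card • 2 ^ ((t - 2) / 2) := (smul_eq_mul _ _).symm
          _ ≤ ∑ r ∈ C', Nat.card (StdFilling m' (Y'.removeAbove (r, Y'.rowLen r - 1))) :=
            card_nsmul_le_sum _ _ _ hterm'

/-! ### Translation to partitions -/

/-- The largest row length of a Young diagram is the length of row `0`.
[cite: FultonYoungTableaux1997, §7.2] -/
theorem sup_rowLens (Y : YoungDiagram) : (Y.rowLens : Multiset ℕ).sup = Y.rowLen 0 := by
  apply le_antisymm
  · refine Multiset.sup_le.2 fun b hb => ?_
    rw [Multiset.mem_coe] at hb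
    obtain ⟨i, hi, rfl⟩ := List.getElem_of_mem hb
    rw [get_rowLens]
    exact Y.rowLen_anti 0 i (Nat.zero_le i)
  · rcases Nat.eq_zero_or_pos (Y.rowLen 0) with h | h
    · rw [h]; exact Nat.zero_le _
    · have hlen : 0 < Y.rowLens.length := by
        rw [length_rowLens, ← mem_iff_lt_colLen]
        exact mem_iff_lt_rowLen.2 h
      have hmem : Y.rowLen 0 ∈ (Y.rowLens : Multiset ℕ) := by
        rw [Multiset.mem_coe, ← get_rowLens (h := hlen)]
        exact List.getElem_mem hlen
      exact Multiset.le_sup hmem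

variable {d : ℕ}

/-- `μ₁` (the largest part) is the length of row `0` of the Young diagram.
[cite: FultonYoungTableaux1997, §7.2] -/
theorem sup_parts_eq_rowLen_zero (μ : Nat.Partition d) : μ.parts.sup = μ.youngDiagram.rowLen 0 := by
  have : μ.parts = (μ.youngDiagram.rowLens : Multiset ℕ) := by
    rw [μ.rowLens_youngDiagram, Nat.Partition.sortedParts, Multiset.sort_eq]
  rw [this, sup_rowLens]

/-- `μ'₁` (the number of parts) is the length of column `0` of the Young diagram.
[cite: FultonYoungTableaux1997, §7.2] -/
theorem sup_parts_transpose_eq_colLen_zero (μ : Nat.Partition d) :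
    μ.transpose.parts.sup = μ.youngDiagram.colLen 0 := by
  change ((μ.youngDiagram.transpose.rowLens : Multiset ℕ)).sup = _
  rw [sup_rowLens, rowLen_transpose]

/-- **The dimension dichotomy** (the cell's `SpechtDimDichotomy`, T-D.3, verbatim): if the first
row and the first column of `μ ⊢ d` both have length `≤ d - t`, then `f^μ ≥ 2^{⌊t/2⌋}`.
Equivalently: `f^μ < 2^k` forces `μ₁ > d - 2k` or `μ'₁ > d - 2k`.
[cite: JamesKerber1981, 2.4.3 and proof of 2.4.10 (lower bounds for dimensions by branching)] -/
theorem spechtDimDichotomy :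
    ∀ (d t : ℕ) (μ : Nat.Partition d), μ.parts.sup + t ≤ d → μ.transpose.parts.sup + t ≤ d →
      2 ^ (t / 2) ≤ numStandardTableaux μ := by
  intro d t μ hrow hcol
  rw [sup_parts_eq_rowLen_zero] at hrow
  rw [sup_parts_transpose_eq_colLen_zero] at hcol
  rw [numStandardTableaux_eq_card_stdFilling]
  exact card_stdFilling_ge_two_pow d t μ.youngDiagram μ.card_cells_youngDiagram hrow hcol

end Literature.NumberTheory.DiophantineGeometry
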